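import Summits.QuantumFields.BalabanUV.Gaps.D1IndexSymmetryDictionary

/-!
# `BalabanUV.Gaps.D1WardBinderResidual` — cell pub-balaban-gaps, row (D1), seat g1-p1: THE MIRROR STATEMENT — WHAT THE END's WARD BINDER `hW` (5.9) BUYS GIVEN THE REFLECTION BINDER `hR`
# (5.7), EXACTLY: FOUR DIAGONAL ZEROTH MOMENTS PER LEVEL («no mass term»), for ANY step-jet data; and that reduction is sharp (a reflection-covariant, index-symmetric mass kernel)

HONEST FRAMING (cell rule, page 1 of everything): [folklore] kernel algebra BY NAME — an1 gen 10's `Beta.OddMoments` §1 (the reflection route: `firstMoment_eq_zero_of_reflectionCovariant`,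
`zerothMoment_eq_zero_of_reflectionCovariant` — (5.7) kills every first moment and every OFF-diagonal zeroth moment, no Ward identity, no summability), the β-lead's socket `Beta.ScalewiseVectorSeam`
(`hasSum_firstMoment_zero_of_reflection`, `hU_of_scalewise`, `oneLoopDrift_of_vectorTails_evenVolume`, `readout122_*`, `splitOf`, `hessianTelescoping_iff_m2Tensor_sum`), `Beta.OneStepKernelFamily`
(`D1Drift`, `D1Tel`, `D1Rep`, `flipK`, `hTA_TbalOf`), GEN 14's `momentSummable_flipK_TbalOf`.  Companion of `Gaps/D1ParityOddFirstMoments` (seat g1-p1 GEN 15: given `hW` + (5.8), `hR` is needed only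
for four parity-odd FIRST moments per level).  Together: the END's two symmetry binders enter the drift socket ONLY through (T0) `Σ_z T_j(c,e,z) = 0` and (T1) `Σ_z z_ρ T_j(c,e,z) = 0`; `hR` alone
gives (T1) and the off-diagonal half of (T0), so given `hR` the Ward binder is consumed ONLY as «the four DIAGONAL zeroth moments `Σ_z T_j(μ,μ,z)` vanish» — the absence of a (diagonal)
MASS TERM `m² A_μA_μ` at zero momentum; and a unit mass kernel shows the four numbers are NOT implied by (5.7) + (5.8) + decay.
WHAT IT IS NOT: `hR`, `D1Tel`, `D1Rep` and the four numbers remain HYPOTHESES — NO binder of row D1 is discharged; nothing of Bałaban's asserted ((5.7)–(5.9) are PRINTED for Bałaban's `Π`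
[Balaban1987RG1 p. 293], used here as predicates on abstract step-jet families); NO coefficient computed or signed; (D1) NOT discharged; 0∕4 row-D1 binders; NOT `BetaPertH`, NOT continuum,
NOT Clay.  HONEST DEPENDENCY (b2b cell, verbatim): «continuum YM on T⁴ ⇐ BetaPertH ∧ nine spine estimates (0/9 proved); BetaPertH ⇐ (D1) ∧ (D4) ∧ CAP+tail; G-an2-4 gates asym, D1 and NE2/3/4.»

CONTENT (all [folklore]; no `def`, 0 sorry): §1 generic (`P : B12Beta.Kernel d`): `hasSum_zero_of_reflection_massFree` ((5.7) + summability + «diagonal zeroth moments vanish» ⟹ the socket's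
(T0)), `massFree_of_ward` (`hW` ⟹ the four numbers), `massFree_iff_four` (d = 4: four equations); §2 ANY step-jet data `Js`, `Jc`: `scalewiseData_of_hR_massFree` (hTA ∕ (T0) ∕ (T1) WITHOUT
`hW` and WITHOUT (5.8)), **`d1Drift_of_D1Tel_D1Rep_of_hR_massFree`** (the END `OneStepKernelFamily.d1Drift_of_D1Tel_D1Rep` with `hW` REPLACED by four diagonal zeroth moments per level),
`d1Tel_iff_m2Tensor_sum_of_hR_massFree`, **`d1Drift_of_D1Tel_D1Rep_of_moments`** (BOTH symmetry binders replaced by the plain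
moment equations (T0) ∧ (T1) of the flipped step kernels — all the socket consumes); §3 SHARPNESS (def-free, the kernel written as the explicit lambda
`fun μ ν z => if μ = ν ∧ z = 0 then 1 else 0` — a unit diagonal mass term): `axisReflectionCovariant_massKernel`, `indexSymmetric_massKernel`, `momentSummable_massKernel`,
`zerothMoment_massKernel_diag` (`= 1`), `not_wardTransversal_massKernel`, **`exists_reflectionCovariant_indexSymmetric_not_T0`**.

Provenance: cell pub-balaban-gaps, seat g1-p1 GEN 15 (prover-pub-balaban-gaps-g1-p1-g15-0), 2026-08-25; imports `Gaps/D1IndexSymmetryDictionary` (p389565 ✓) only; no existing file touched.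
-/

noncomputable section

open Literature.MathematicalPhysics.QuantumFieldTheory Balaban1983to89 Balaban1983to89.Beta Filter Topology
open OneStepResolventKernel (JetData)
open OneStepKernelFamily (TbalOf TshotOf flipK D1Drift D1Tel D1Rep hTA_TbalOf hasSum_flipK_iff hasSum_firstMoment_of_flipK)
open PolarizationSign (IndexSymmetric WardTransversal AxisReflectionCovariant MomentSummable axisReflect reflSign size tsum_eq_zero_of_ward)
open OddMoments (zerothMoment firstMoment firstMoment_eq_zero_of_reflectionCovariant zerothMoment_eq_zero_of_reflectionCovariant summable_self summable_mul_coord)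
open ScalewiseVectorSeam (hasSum_firstMoment_zero_of_reflection hU_of_scalewise readout122 readout122_add readout122_m2Tensor oneShotFullSum_readout122_iff
  oneLoopDrift_of_vectorTails_evenVolume splitOf oneShotSide hessianTelescoping_iff_m2Tensor_sum)
open DressedMomentNormalisation (EKer m2Tensor)
open DecimatedMomentSummable (AbsMoment₂)
open HidentScalewise (HessianTelescoping identityForm_trivial)
open Drift (OneLoopDrift)
open FlowStep FlowStepRuns DagBinding
open VectorTailsLoc (fam kfam)
open VectorLegVolumeAdapter (MvE)
open B6BondElimination (unitVec unitVec_apply)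
open Summit.QuantumFields.BalabanUV.Gaps.D1IndexSymmetryDictionary (momentSummable_flipK_TbalOf)

namespace Summit.QuantumFields.BalabanUV.Gaps.D1WardBinderResidual

/-! ## §1 Generic: given (5.7), (T0) ⟺ the diagonal zeroth moments vanish -/

section Generic

variable {d : ℕ}

/-- [folklore] **(T0) FROM (5.7) + THE DIAGONAL ZEROTH MOMENTS**: reflection covariance kills every off-diagonal zeroth moment (an1 §1, no summability); with summable entries and
«`Σ_z P_{μμ}(z) = 0` for every `μ`» the socket's (T0) `HasSum (P c e) 0` holds for every channel. -/
theorem hasSum_zero_of_reflection_massFree {P : B12Beta.Kernel d} (hP : MomentSummable P 3) (hR : AxisReflectionCovariant P)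
    (hmass : ∀ μ : Fin d, zerothMoment P μ μ = 0) (c e : Fin d) : HasSum (P c e) 0 := by
  have h := (summable_self hP c e).hasSum
  have h0 : zerothMoment P c e = 0 := by
    by_cases hce : c = e
    · subst hce; exact hmass c
    · exact zerothMoment_eq_zero_of_reflectionCovariant hR hce
  unfold OddMoments.zerothMoment at h0
  rwa [h0] at h

/-- [folklore] `hW` ⟹ the reduced hypothesis: under (5.9) + summable third moments EVERY zeroth moment vanishes (the host's `tsum_eq_zero_of_ward`), in particular the diagonal ones — so
every END below with the reduced hypothesis generalises the END with `hW`. -/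
theorem massFree_of_ward {P : B12Beta.Kernel d} (hP : MomentSummable P 3) (hW : WardTransversal P) (μ : Fin d) : zerothMoment P μ μ = 0 :=
  tsum_eq_zero_of_ward hP hW μ μ

/-- [folklore] In FOUR dimensions the reduced hypothesis IS four equations: `m₀(0,0) = m₀(1,1) = m₀(2,2) = m₀(3,3) = 0` (the diagonal of the zero-momentum «mass matrix»). -/
theorem massFree_iff_four {P : B12Beta.Kernel 4} :
    (∀ μ : Fin 4, zerothMoment P μ μ = 0) ↔ zerothMoment P 0 0 = 0 ∧ zerothMoment P 1 1 = 0 ∧ zerothMoment P 2 2 = 0 ∧ zerothMoment P 3 3 = 0 := by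
  refine ⟨fun h => ⟨h 0, h 1, h 2, h 3⟩, fun h μ => ?_⟩
  obtain ⟨h0, h1, h2, h3⟩ := h
  fin_cases μ
  · exact h0
  · exact h1
  · exact h2
  · exact h3

end Generic

/-! ## §2 Generic step-jet data: the END with `hW` replaced by (5.7) + four diagonal zeroth moments per level -/

section StepJets

variable {Lc : ℕ} [NeZero Lc] {L : Type*}

/-- [folklore] The socket's per-step data WITHOUT `hW` (and without (5.8)): (T1) from `hR` (`ScalewiseVectorSeam.hasSum_firstMoment_zero_of_reflection`), (T0) from `hR` + the diagonal
zeroth moments (§1), both flipped back to the step kernels. -/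
theorem scalewiseData_of_hR_massFree (Js : ℕ → JetData 3 Lc)
    (hR : ∀ j, AxisReflectionCovariant (flipK (TbalOf Lc Js j))) (hmass : ∀ j (μ : Fin 4), zerothMoment (flipK (TbalOf Lc Js j)) μ μ = 0) :
    (∀ j c e, AbsMoment₂ (TbalOf Lc Js j c e)) ∧ (∀ j c e, HasSum (TbalOf Lc Js j c e) 0) ∧
      (∀ j c e (ρ : Fin 4), HasSum (fun t : Fin 4 → ℤ => t ρ • TbalOf Lc Js j c e t) 0) :=
  ⟨hTA_TbalOf Js,
    fun j c e => hasSum_flipK_iff.mp (hasSum_zero_of_reflection_massFree (momentSummable_flipK_TbalOf Js j 3) (hR j) (hmass j) c e),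
    fun j c e ρ => hasSum_firstMoment_of_flipK (hasSum_firstMoment_zero_of_reflection (momentSummable_flipK_TbalOf Js j 3) (hR j) c e ρ)⟩

/-- [folklore] **THE END's DRIFT WITH `hW` REPLACED** (any step-jet data `Js`, any composite data `Jc`): `OneStepKernelFamily.d1Drift_of_D1Tel_D1Rep` with the Ward binder
`hW : ∀ j, WardTransversal (flipK (TbalOf Lc Js j))` replaced by the vanishing of the four DIAGONAL zeroth moments of the flipped step kernels (`hmass`) — given `hR`, nothing else of
(5.9) is consumed.  Same socket; `hR`, `hmass`, `htel`, `hrep` are HYPOTHESES about the jet data, never facts.  It GENERALISES the printed-binder END: with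
`hmass := fun j μ => massFree_of_ward (momentSummable_flipK_TbalOf Js j 3) (hW j) μ` it is `OneStepKernelFamily.d1Drift_of_D1Tel_D1Rep` verbatim (not restated: `dedup`). -/
theorem d1Drift_of_D1Tel_D1Rep_of_hR_massFree (a : ℝ) (ha : 0 < a)
    (h12 : B5.Prop12Printed (fam (fun i : ℕ+ × ℕ => ((i.1 : ℕ+) : ℕ)) (fun i => i.1.pos) MvE a ha))
    (h126 : B5.Kernel126_127Printed (kfam (fun i : ℕ+ × ℕ => ((i.1 : ℕ+) : ℕ)) MvE))
    {SL : Finset L} (hSL : SL.Nonempty) (k : L → Fin 4) {μ ν : Fin 4} (hμν : μ ≠ ν) {N : ℝ} (hN : N ≠ 0) (hL : 2 ≤ Lc)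
    (Js : ℕ → JetData 3 Lc) (Jc : ∀ m : ℕ, JetData 3 (Lc ^ m))
    (hR : ∀ j, AxisReflectionCovariant (flipK (TbalOf Lc Js j))) (hmass : ∀ j (μ : Fin 4), zerothMoment (flipK (TbalOf Lc Js j)) μ μ = 0)
    (htel : D1Tel Lc Js Jc)
    {cc : ℝ} {M : ℕ → ℕ} (hc : 1 ≤ cc) (hM : ∀ L : ℕ, 2 ≤ L → 1 ≤ M L ∧ (L : ℝ) ≤ cc * M L) (hML : ∀ L : ℕ, 2 ≤ L → M L ≤ L)
    (hrep : D1Rep Lc Jc N μ ν a SL k) : D1Drift Lc Js N μ ν := by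
  obtain ⟨U, hU⟩ := hrep
  obtain ⟨hTA, hT0, hT1⟩ := scalewiseData_of_hR_massFree Js hR hmass
  have hβ' : ∀ j, (splitOf fun j => B12Beta.secondMoment (TbalOf Lc Js j) μ ν).β0 j = readout122 μ ν (m2Tensor (TbalOf Lc Js j)) := fun j => by
    rw [readout122_m2Tensor]; rfl
  exact oneLoopDrift_of_vectorTails_evenVolume a ha h12 h126 hSL k (splitOf fun j => B12Beta.secondMoment (TbalOf Lc Js j) μ ν) hμν hN hL hc hM hML
    (hU_of_scalewise hTA hT0 hT1 htel (readout122_add μ ν) hβ' (oneShotFullSum_readout122_iff.mpr hU)) (identityForm_trivial _)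

/-- [folklore] `D1Tel` REDUCED WITHOUT `hW`: under `hR` + the diagonal zeroth moments, Hessian telescoping IS second-moment-tensor additivity. -/
theorem d1Tel_iff_m2Tensor_sum_of_hR_massFree (Js : ℕ → JetData 3 Lc) (Jc : ∀ m : ℕ, JetData 3 (Lc ^ m))
    (hR : ∀ j, AxisReflectionCovariant (flipK (TbalOf Lc Js j))) (hmass : ∀ j (μ : Fin 4), zerothMoment (flipK (TbalOf Lc Js j)) μ μ = 0) :
    D1Tel Lc Js Jc ↔ ∀ m : ℕ, 1 ≤ m → m2Tensor (TshotOf Lc Jc m) = ∑ j ∈ Finset.range m, m2Tensor (TbalOf Lc Js j) := by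
  obtain ⟨hTA, hT0, hT1⟩ := scalewiseData_of_hR_massFree Js hR hmass
  exact hessianTelescoping_iff_m2Tensor_sum hTA hT0 hT1

/-- [folklore] **THE END WITH BOTH SYMMETRY BINDERS REPLACED BY WHAT THE SOCKET CONSUMES** (any step-jet data): `d1Drift_of_D1Tel_D1Rep` with `hW` AND `hR` replaced by the plain
moment equations (T0) `Σ_z T_j(c,e,z) = 0` (all `c e`) and (T1) `Σ_z z_γ T_j(c,e,z) = 0` (all `c e γ`) of the flipped step kernels (as `tsum` equalities; summability is automatic from an4's
decay via GEN 14's `momentSummable_flipK_TbalOf`).  Both reduced ENDs — this file's (`hR` + four diagonal zeroth moments) and `Gaps/D1ParityOddFirstMoments`' (`hW` + (5.8) + four parity-odd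
first moments) — are instances; nothing else of (5.7)∕(5.9) reaches the drift socket. -/
theorem d1Drift_of_D1Tel_D1Rep_of_moments (a : ℝ) (ha : 0 < a)
    (h12 : B5.Prop12Printed (fam (fun i : ℕ+ × ℕ => ((i.1 : ℕ+) : ℕ)) (fun i => i.1.pos) MvE a ha))
    (h126 : B5.Kernel126_127Printed (kfam (fun i : ℕ+ × ℕ => ((i.1 : ℕ+) : ℕ)) MvE))
    {SL : Finset L} (hSL : SL.Nonempty) (k : L → Fin 4) {μ ν : Fin 4} (hμν : μ ≠ ν) {N : ℝ} (hN : N ≠ 0) (hL : 2 ≤ Lc)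
    (Js : ℕ → JetData 3 Lc) (Jc : ∀ m : ℕ, JetData 3 (Lc ^ m))
    (h0 : ∀ j (c e : Fin 4), zerothMoment (flipK (TbalOf Lc Js j)) c e = 0) (h1 : ∀ j (c e γ : Fin 4), firstMoment (flipK (TbalOf Lc Js j)) c e γ = 0)
    (htel : D1Tel Lc Js Jc)
    {cc : ℝ} {M : ℕ → ℕ} (hc : 1 ≤ cc) (hM : ∀ L : ℕ, 2 ≤ L → 1 ≤ M L ∧ (L : ℝ) ≤ cc * M L) (hML : ∀ L : ℕ, 2 ≤ L → M L ≤ L)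
    (hrep : D1Rep Lc Jc N μ ν a SL k) : D1Drift Lc Js N μ ν := by
  obtain ⟨U, hU⟩ := hrep
  have hT0 : ∀ j c e, HasSum (TbalOf Lc Js j c e) 0 := fun j c e => by
    have h := (summable_self (momentSummable_flipK_TbalOf Js j 3) c e).hasSum
    have h' : ∑' z, flipK (TbalOf Lc Js j) c e z = 0 := h0 j c e
    rw [h'] at h
    exact hasSum_flipK_iff.mp h
  have hT1 : ∀ j c e (ρ : Fin 4), HasSum (fun t : Fin 4 → ℤ => t ρ • TbalOf Lc Js j c e t) 0 := fun j c e ρ => by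
    refine hasSum_firstMoment_of_flipK ?_
    have hfun : (fun t : Fin 4 → ℤ => t ρ • flipK (TbalOf Lc Js j) c e t) = fun t => flipK (TbalOf Lc Js j) c e t * (t ρ : ℝ) := by
      funext t; rw [zsmul_eq_mul, mul_comm]
    rw [hfun]
    have h := (summable_mul_coord (momentSummable_flipK_TbalOf Js j 3) c e ρ).hasSum
    have h' : ∑' z, flipK (TbalOf Lc Js j) c e z * (z ρ : ℝ) = 0 := h1 j c e ρ
    rwa [h'] at h
  have hβ' : ∀ j, (splitOf fun j => B12Beta.secondMoment (TbalOf Lc Js j) μ ν).β0 j = readout122 μ ν (m2Tensor (TbalOf Lc Js j)) := fun j => by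
    rw [readout122_m2Tensor]; rfl
  exact oneLoopDrift_of_vectorTails_evenVolume a ha h12 h126 hSL k (splitOf fun j => B12Beta.secondMoment (TbalOf Lc Js j) μ ν) hμν hN hL hc hM hML
    (hU_of_scalewise (hTA_TbalOf Js) hT0 hT1 htel (readout122_add μ ν) hβ' (oneShotFullSum_readout122_iff.mpr hU)) (identityForm_trivial _)

end StepJets

/-! ## §3 Sharpness: a unit diagonal mass kernel obeys (5.7) and (5.8), has every moment summable, and a nonzero diagonal zeroth moment — (5.7) + (5.8) do NOT give (T0) -/

section Mass

variable {d : ℕ}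

/-- [folklore] The unit diagonal MASS KERNEL `P_{μν}(z) = [μ = ν][z = 0]` (the zero-momentum form of `A_μ A_μ`) is axis-reflection covariant (5.7): at `μ = ν` the two unit shifts cancel and
the sign is `ε_μ² = 1`; off the diagonal both sides vanish. -/
theorem axisReflectionCovariant_massKernel : AxisReflectionCovariant (fun (μ ν : Fin d) (z : Fin d → ℤ) => if μ = ν ∧ z = 0 then (1 : ℝ) else 0) := by
  intro α μ ν z
  by_cases hμν : μ = ν
  · subst hμν
    have hz : (axisReflect α z - (if μ = α then unitVec α else 0) + (if μ = α then unitVec α else 0) = 0) ↔ z = 0 := by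
      rw [sub_add_cancel]
      constructor
      · intro h
        have := congrArg (axisReflect α) h
        rw [PolarizationSign.axisReflect_axisReflect] at this
        rw [this]; funext i; simp [PolarizationSign.axisReflect_apply]
      · intro h; rw [h]; funext i; simp [PolarizationSign.axisReflect_apply]
    have hs : reflSign α μ * reflSign α μ = 1 := by unfold PolarizationSign.reflSign; split_ifs <;> norm_num
    simp only [true_and, hz]
    rw [hs, one_mul]
  · simp [hμν]

/-- [folklore] The mass kernel is index-symmetric (5.8). -/
theorem indexSymmetric_massKernel : IndexSymmetric (fun (μ ν : Fin d) (z : Fin d → ℤ) => if μ = ν ∧ z = 0 then (1 : ℝ) else 0) := by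
  intro μ ν z
  by_cases h : μ = ν
  · subst h; simp [neg_eq_zero]
  · simp [h, Ne.symm h]

/-- [folklore] Every polynomial moment of the mass kernel is summable (support `{0}`). -/
theorem momentSummable_massKernel (n : ℕ) : MomentSummable (fun (μ ν : Fin d) (z : Fin d → ℤ) => if μ = ν ∧ z = 0 then (1 : ℝ) else 0) n := fun μ ν =>
  summable_of_ne_finset_zero (s := {0}) fun z hz => by
    have hz' : z ≠ 0 := by simpa using hz
    simp [hz']

/-- [folklore] **THE DIAGONAL ZEROTH MOMENT OF THE MASS KERNEL IS `1`**. -/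
theorem zerothMoment_massKernel_diag (μ : Fin d) : zerothMoment (fun (μ ν : Fin d) (z : Fin d → ℤ) => if μ = ν ∧ z = 0 then (1 : ℝ) else 0) μ μ = 1 := by
  unfold OddMoments.zerothMoment
  rw [tsum_eq_single 0 fun z hz => by simp [hz]]
  simp

/-- [folklore] Hence the mass kernel VIOLATES the reduced hypothesis of §2 and the Ward identity (5.9) (the host's `tsum_eq_zero_of_ward` would force the zeroth moment to vanish):
(5.7) + (5.8) + decay do NOT imply `hW`'s residual content. -/
theorem not_wardTransversal_massKernel [NeZero d] : ¬ WardTransversal (fun (μ ν : Fin d) (z : Fin d → ℤ) => if μ = ν ∧ z = 0 then (1 : ℝ) else 0) := fun hW => by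
  have h := tsum_eq_zero_of_ward (momentSummable_massKernel 3) hW (0 : Fin d) 0
  have h1 := zerothMoment_massKernel_diag (d := d) 0
  unfold OddMoments.zerothMoment at h1
  rw [h] at h1
  norm_num at h1

/-- [folklore] **SHARPNESS, AS AN EXISTENCE STATEMENT**: there is a kernel on `ℤ⁴` obeying (5.7) and (5.8) with every polynomial moment summable whose diagonal zeroth moments do NOT all
vanish — the socket's (T0) is not a consequence of `hR` + (5.8) + decay; the four diagonal zeroth moments per level are the irreducible content of `hW` modulo `hR`. -/
theorem exists_reflectionCovariant_indexSymmetric_not_T0 :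
    ∃ P : B12Beta.Kernel 4, AxisReflectionCovariant P ∧ IndexSymmetric P ∧ (∀ n, MomentSummable P n) ∧ ¬ ∀ μ : Fin 4, zerothMoment P μ μ = 0 :=
  ⟨_, axisReflectionCovariant_massKernel, indexSymmetric_massKernel, momentSummable_massKernel, fun h => by
    have h1 := zerothMoment_massKernel_diag (d := 4) 0
    rw [h 0] at h1
    norm_num at h1⟩

end Mass

end Summit.QuantumFields.BalabanUV.Gaps.D1WardBinderResidual

end
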